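import Literature.Analysis.FluidPDE.FracLaplacianSpaceTime
import Literature.Analysis.FunctionSpaces.TorusFractionalSobolevEmbedding
import Literature.Analysis.FunctionSpaces.TorusConvectionLaplacianNormSq
import HarnessLib
/-!
# FunctionalMining — hyperdissipative units, Fourier side: `‖Λ^θ∇u‖₂²` on `T³`, its symbol
# interpolation, and `Ḣ^{3/4}(T³) ⊂ L⁴` for the gradient

Search for candidate a priori estimates; no regularity claim. Cell `pub-nsfunc`, prove seat
(gen 25). Support file (part 1 of 2) for the kernel form of the paper fragment `estimates.tex`
Prop. "fragments with honest scope" (d) — the enstrophy budget of the hyperdissipative model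
`∂ₜu + P(u·∇)u = −νΛ^{2α}u` closes at J.-L. Lions' exponent `α = 5/4` (part 2:
`HyperdissipativeStretching.lean`). Everything here is fixed-field bookkeeping on the unit torus
`T³ = UnitAddTorus (Fin 3)` with the tree's spectral fractional Laplacian
`Torus.fracLaplacian θ = (−Δ)^θ = Λ^{2θ}` (symbol `(4π²|k|²)^θ`):

* `fracGradPairing θ u := ∑ₘ ∫ ⟪∂ₘu, (−Δ)^θ ∂ₘu⟫ = ‖Λ^θ ∇u‖₂²`, its Fourier series
  `∑ₘ ∑ₖ (4π²|k|²)^θ ‖(∂ₘu)^(k)‖²` (`fracGradPairing_eq_sum_tsum`) and non-negativity;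
* `fracGradPairing_threeQuarter_le` — the symbol interpolation
  `‖Λ^{3/4}∇u‖₂² ≤ (ε/2)‖Λ^{5/4}∇u‖₂² + (1/(2ε))‖Λ^{1/4}∇u‖₂²` for every `ε > 0`
  (termwise `x^{3/4} ≤ (εx^{5/4} + ε⁻¹x^{1/4})/2`);
* `exists_integral_gradSq_sq_le_fracGradPairing_sq` — `∫|∇u|⁴ ≤ C ‖Λ^{3/4}∇u‖₂⁴`, the fractional
  Sobolev inequality `Ḣ^{3/4}(T³) ⊂ L⁴` (tree `Torus.exists_integral_rpow_norm_le_hsSeminorm`,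
  Robinson–Rodrigo–Sadowski 2016 Thm 1.19 / Bényi–Oh 2013) applied to the zero-mean fields `∂ₘu`;
* `fracGradPairing_quarter_eq` — `‖Λ^{1/4}∇u‖₂² = ∫⟪u, (−Δ)^{5/4}u⟫ = ‖Λ^{5/4}u‖₂²`, the
  energy-dissipation rate (per unit viscosity) of the `α = 5/4` model.

Constants existential. Nothing here is about Navier–Stokes regularity. [ours]
-/
noncomputable section

open MeasureTheory Set Filter Topology Finset
open scoped InnerProductSpace

namespace Summit.NavierStokesRegularity.FunctionalMining

namespace HyperNS

open Literature.Analysis.FunctionSpaces Literature.Analysis.FunctionSpaces.Torus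
open Literature.Analysis.FluidPDE Literature.Analysis.FluidPDE.Torus
/-! ## 1. `‖Λ^θ ∇u‖₂²` as a pairing and as a Fourier series -/

/-- **`fracGradPairing θ u = ∑ₘ ∫ ⟪∂ₘu, (−Δ)^θ ∂ₘu⟫ = ‖Λ^θ ∇u‖₂²`** on `T³` (`Λ = (−Δ)^{1/2}`,
`Torus.fracLaplacian θ = Λ^{2θ}`). At `θ = 5/4` this is the enstrophy dissipation of the `α = 5/4`
hyperdissipative model; at `θ = 1/4` it is `‖Λ^{5/4}u‖₂²`, that model's energy dissipation.
[ours, bookkeeping] -/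
def fracGradPairing (θ : ℝ) (u : UnitAddTorus (Fin 3) → EuclideanSpace ℝ (Fin 3)) : ℝ :=
  ∑ m, ∫ x, ⟪Torus.partialDeriv m u x, fracLaplacian θ (Torus.partialDeriv m u) x⟫_ℝ

/-- The Fourier coefficient modulus squared of `∂ₘu` at frequency `k`. [ours, bookkeeping] -/
def gradCoeffSq (u : UnitAddTorus (Fin 3) → EuclideanSpace ℝ (Fin 3)) (m : Fin 3) (k : Fin 3 → ℤ) : ℝ :=
  ‖UnitAddTorus.mFourierCoeff (EuclideanSpace.complexify ∘ Torus.partialDeriv m u) k‖ ^ 2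

/-- `gradCoeffSq u m k ≥ 0`. [ours, bookkeeping] -/
theorem gradCoeffSq_nonneg (u : UnitAddTorus (Fin 3) → EuclideanSpace ℝ (Fin 3)) (m : Fin 3)
    (k : Fin 3 → ℤ) : 0 ≤ gradCoeffSq u m k := by
  unfold gradCoeffSq; exact sq_nonneg _

/-- **The self-pairing in Fourier variables**: for smooth `v` and `θ ≥ 0`,
`∫ ⟪v, (−Δ)^θ v⟫ = ∑ₖ (4π²|k|²)^θ ‖v̂(k)‖²` (tree `Torus.integral_inner_fracLaplacian_eq_tsum` with
`b = a`, `Re ⟪z, z⟫ = ‖z‖²`; the symmetric order `⟪(−Δ)^γ v, v⟫` is the tree's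
`Torus.integral_inner_fracLaplacian_self_eq_tsum` of `DeRosaPertEnergyRate`, not imported here). [ours, bookkeeping] -/
theorem integral_inner_self_fracLaplacian_eq_tsum {θ : ℝ} (hθ : 0 ≤ θ)
    {v : UnitAddTorus (Fin 3) → EuclideanSpace ℝ (Fin 3)} (hv : Torus.IsSmooth v) :
    ∫ x, ⟪v x, fracLaplacian θ v x⟫_ℝ =
      ∑' k : Fin 3 → ℤ, fracSymbol θ k * ‖UnitAddTorus.mFourierCoeff (EuclideanSpace.complexify ∘ v) k‖ ^ 2 := by
  rw [integral_inner_fracLaplacian_eq_tsum hθ hv hv.continuous]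
  refine tsum_congr fun k => ?_
  congr 1
  have h := inner_self_eq_norm_sq (𝕜 := ℂ) (UnitAddTorus.mFourierCoeff (EuclideanSpace.complexify ∘ v) k)
  simpa using h

/-- The series `∑ₖ (4π²|k|²)^θ ‖v̂(k)‖²` converges for smooth `v`, `θ ≥ 0`. [ours, bookkeeping] -/
theorem summable_fracSymbol_mul_norm_sq {θ : ℝ} (hθ : 0 ≤ θ)
    {v : UnitAddTorus (Fin 3) → EuclideanSpace ℝ (Fin 3)} (hv : Torus.IsSmooth v) :
    Summable fun k : Fin 3 → ℤ =>
      fracSymbol θ k * ‖UnitAddTorus.mFourierCoeff (EuclideanSpace.complexify ∘ v) k‖ ^ 2 := by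
  have h := hv.summable_freqNormSq_rpow_mul_norm_sq hθ
  have h2 := h.mul_left ((4 * Real.pi ^ 2) ^ θ)
  refine h2.congr fun k => ?_
  rw [fracSymbol, Real.mul_rpow (by positivity) (freqNormSq_nonneg k)]
  ring

/-- **`‖Λ^θ∇u‖₂²` as a double series**: `fracGradPairing θ u = ∑ₘ ∑ₖ (4π²|k|²)^θ ‖(∂ₘu)^(k)‖²`
for smooth `u`, `θ ≥ 0`. [ours, bookkeeping] -/
theorem fracGradPairing_eq_sum_tsum {θ : ℝ} (hθ : 0 ≤ θ)
    {u : UnitAddTorus (Fin 3) → EuclideanSpace ℝ (Fin 3)} (hu : Torus.IsSmooth u) :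
    fracGradPairing θ u = ∑ m, ∑' k : Fin 3 → ℤ, fracSymbol θ k * gradCoeffSq u m k := by
  unfold fracGradPairing gradCoeffSq
  refine Finset.sum_congr rfl fun m _ => ?_
  exact integral_inner_self_fracLaplacian_eq_tsum hθ (hu.partialDeriv m)

/-- `‖Λ^θ∇u‖₂² ≥ 0` for smooth `u`, `θ ≥ 0`. [ours, bookkeeping] -/
theorem fracGradPairing_nonneg {θ : ℝ} (hθ : 0 ≤ θ)
    {u : UnitAddTorus (Fin 3) → EuclideanSpace ℝ (Fin 3)} (hu : Torus.IsSmooth u) :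
    0 ≤ fracGradPairing θ u := by
  rw [fracGradPairing_eq_sum_tsum hθ hu]
  exact Finset.sum_nonneg fun m _ => tsum_nonneg fun k =>
    mul_nonneg (fracSymbol_nonneg θ k) (gradCoeffSq_nonneg u m k)

/-! ## 2. The symbol interpolation `x^{3/4} ≤ (ε x^{5/4} + ε⁻¹ x^{1/4})/2` -/

/-- For `x ≥ 0` and `ε > 0`: `x^{3/4} ≤ (ε x^{5/4} + ε⁻¹ x^{1/4}) / 2` (AM–GM on
`x^{3/4} = √(x^{5/4} x^{1/4})`). [ours, elementary] -/
theorem rpow_threeQuarter_le (x ε : ℝ) (hx : 0 ≤ x) (hε : 0 < ε) :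
    x ^ (3 / 4 : ℝ) ≤ (ε * x ^ (5 / 4 : ℝ) + ε⁻¹ * x ^ (1 / 4 : ℝ)) / 2 := by
  have ha : 0 ≤ x ^ (5 / 4 : ℝ) := Real.rpow_nonneg hx _
  have hb : 0 ≤ x ^ (1 / 4 : ℝ) := Real.rpow_nonneg hx _
  have hprod : x ^ (5 / 4 : ℝ) * x ^ (1 / 4 : ℝ) = (x ^ (3 / 4 : ℝ)) ^ 2 := by
    rw [← Real.rpow_add' hx (by norm_num), ← Real.rpow_natCast, ← Real.rpow_mul hx]
    norm_num
  -- `(√ε a − b/√ε)² ≥ 0` with `a = x^{5/8}`-type square roots: use `2 p q ≤ ε p² + ε⁻¹ q²`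
  have hsq : 0 ≤ (Real.sqrt ε * Real.sqrt (x ^ (5 / 4 : ℝ)) -
      (Real.sqrt ε)⁻¹ * Real.sqrt (x ^ (1 / 4 : ℝ))) ^ 2 := sq_nonneg _
  have hεs : Real.sqrt ε ^ 2 = ε := Real.sq_sqrt hε.le
  have hεs0 : 0 < Real.sqrt ε := Real.sqrt_pos.2 hε
  have hA : Real.sqrt (x ^ (5 / 4 : ℝ)) ^ 2 = x ^ (5 / 4 : ℝ) := Real.sq_sqrt ha
  have hB : Real.sqrt (x ^ (1 / 4 : ℝ)) ^ 2 = x ^ (1 / 4 : ℝ) := Real.sq_sqrt hb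
  have hAB : Real.sqrt (x ^ (5 / 4 : ℝ)) * Real.sqrt (x ^ (1 / 4 : ℝ)) = x ^ (3 / 4 : ℝ) := by
    rw [← Real.sqrt_mul ha, hprod, Real.sqrt_sq (Real.rpow_nonneg hx _)]
  have hexp : (Real.sqrt ε * Real.sqrt (x ^ (5 / 4 : ℝ)) -
      (Real.sqrt ε)⁻¹ * Real.sqrt (x ^ (1 / 4 : ℝ))) ^ 2 =
      ε * x ^ (5 / 4 : ℝ) + ε⁻¹ * x ^ (1 / 4 : ℝ) - 2 * x ^ (3 / 4 : ℝ) := by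
    have hne : Real.sqrt ε ≠ 0 := hεs0.ne'
    rw [sub_sq, mul_pow, mul_pow, hA, hB, hεs, inv_pow, hεs,
      show 2 * (Real.sqrt ε * Real.sqrt (x ^ (5 / 4 : ℝ))) * ((Real.sqrt ε)⁻¹ * Real.sqrt (x ^ (1 / 4 : ℝ)))
        = 2 * (Real.sqrt ε * (Real.sqrt ε)⁻¹) * (Real.sqrt (x ^ (5 / 4 : ℝ)) * Real.sqrt (x ^ (1 / 4 : ℝ))) by ring,
      mul_inv_cancel₀ hne, hAB]
    ring
  rw [hexp] at hsq
  linarith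

/-- **Symbol interpolation of `‖Λ^{3/4}∇u‖₂²` between `‖Λ^{1/4}∇u‖₂²` and `‖Λ^{5/4}∇u‖₂²`:**
for smooth `u` on `T³` and every `ε > 0`,
`fracGradPairing (3/4) u ≤ (ε · fracGradPairing (5/4) u + ε⁻¹ · fracGradPairing (1/4) u) / 2`
(termwise on the Fourier side, `(4π²|k|²)^{3/4} ≤ (ε(4π²|k|²)^{5/4} + ε⁻¹(4π²|k|²)^{1/4})/2`).
[ours] -/
theorem fracGradPairing_threeQuarter_le {u : UnitAddTorus (Fin 3) → EuclideanSpace ℝ (Fin 3)}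
    (hu : Torus.IsSmooth u) {ε : ℝ} (hε : 0 < ε) :
    fracGradPairing (3 / 4) u ≤
      (ε * fracGradPairing (5 / 4) u + ε⁻¹ * fracGradPairing (1 / 4) u) / 2 := by
  rw [fracGradPairing_eq_sum_tsum (by norm_num) hu, fracGradPairing_eq_sum_tsum (by norm_num) hu,
    fracGradPairing_eq_sum_tsum (by norm_num) hu, Finset.mul_sum, Finset.mul_sum,
    ← Finset.sum_add_distrib, Finset.sum_div]
  refine Finset.sum_le_sum fun m _ => ?_
  have hS5 : Summable fun k : Fin 3 → ℤ => fracSymbol (5 / 4) k * gradCoeffSq u m k :=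
    summable_fracSymbol_mul_norm_sq (by norm_num) (hu.partialDeriv m)
  have hS1 : Summable fun k : Fin 3 → ℤ => fracSymbol (1 / 4) k * gradCoeffSq u m k :=
    summable_fracSymbol_mul_norm_sq (by norm_num) (hu.partialDeriv m)
  have hS3 : Summable fun k : Fin 3 → ℤ => fracSymbol (3 / 4) k * gradCoeffSq u m k :=
    summable_fracSymbol_mul_norm_sq (by norm_num) (hu.partialDeriv m)
  rw [← hS5.tsum_mul_left, ← hS1.tsum_mul_left, ← (hS5.mul_left ε).tsum_add (hS1.mul_left ε⁻¹),
    ← tsum_div_const]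
  refine hS3.tsum_le_tsum (fun k => ?_) (((hS5.mul_left ε).add (hS1.mul_left ε⁻¹)).div_const _)
  have hx : 0 ≤ 4 * Real.pi ^ 2 * freqNormSq k := by
    have := freqNormSq_nonneg k; positivity
  have h := rpow_threeQuarter_le _ ε hx hε
  have hg := gradCoeffSq_nonneg u m k
  simp only [fracSymbol]
  calc (4 * Real.pi ^ 2 * freqNormSq k) ^ (3 / 4 : ℝ) * gradCoeffSq u m k
      ≤ (ε * (4 * Real.pi ^ 2 * freqNormSq k) ^ (5 / 4 : ℝ) +
          ε⁻¹ * (4 * Real.pi ^ 2 * freqNormSq k) ^ (1 / 4 : ℝ)) / 2 * gradCoeffSq u m k :=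
        mul_le_mul_of_nonneg_right h hg
    _ = (ε * ((4 * Real.pi ^ 2 * freqNormSq k) ^ (5 / 4 : ℝ) * gradCoeffSq u m k) +
          ε⁻¹ * ((4 * Real.pi ^ 2 * freqNormSq k) ^ (1 / 4 : ℝ) * gradCoeffSq u m k)) / 2 := by ring
/-! ## 3. `Ḣ^{3/4}(T³) ⊂ L⁴` for the gradient: `∫|∇u|⁴ ≤ C ‖Λ^{3/4}∇u‖₂⁴` -/

/-- For smooth `v` on `T³` with zero mean: `∫ ‖v‖⁴ ≤ C (∫⟪v, (−Δ)^{3/4} v⟫)²` — the fractional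
Sobolev inequality `Ḣ^{3/4} ⊂ L⁴` (tree `Torus.exists_integral_rpow_norm_le_hsSeminorm` at `s = 3/4`,
`n = 3`, `q = 4`; the printed seminorm `∑|k|^{3/2}‖v̂(k)‖²` is `≤ ∑(4π²|k|²)^{3/4}‖v̂(k)‖²`).
[ours, bookkeeping] -/
theorem exists_integral_norm_pow_four_le_pairing_sq :
    ∃ C : ℝ, 0 ≤ C ∧ ∀ v : UnitAddTorus (Fin 3) → EuclideanSpace ℝ (Fin 3), Torus.IsSmooth v →
      Torus.HasZeroMean v →
      ∫ x, ‖v x‖ ^ 4 ≤ C * (∫ x, ⟪v x, fracLaplacian (3 / 4) v x⟫_ℝ) ^ 2 := by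
  obtain ⟨C, hC0, hC⟩ := exists_integral_rpow_norm_le_hsSeminorm (d := Fin 3) (s := 3 / 4)
    (by norm_num) (by norm_num [Fintype.card_fin])
  refine ⟨C, hC0.le, fun v hv h0 => ?_⟩
  have h := hC v hv h0
  have e1 : (2 * (Fintype.card (Fin 3) : ℝ) / ((Fintype.card (Fin 3) : ℝ) - 2 * (3 / 4))) = (4 : ℕ) := by
    norm_num [Fintype.card_fin]
  have e2 : ((Fintype.card (Fin 3) : ℝ) / ((Fintype.card (Fin 3) : ℝ) - 2 * (3 / 4))) = (2 : ℕ) := by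
    norm_num [Fintype.card_fin]
  rw [e1, e2, Real.rpow_natCast] at h
  simp_rw [Real.rpow_natCast] at h
  -- the printed seminorm is dominated by the pairing
  set H : ℝ := ∑' k : Fin 3 → ℤ,
    freqNormSq k ^ (3 / 4 : ℝ) * ‖UnitAddTorus.mFourierCoeff (EuclideanSpace.complexify ∘ v) k‖ ^ 2 with hH
  set P : ℝ := ∫ x, ⟪v x, fracLaplacian (3 / 4) v x⟫_ℝ with hP
  have hH0 : 0 ≤ H := tsum_nonneg fun k =>
    mul_nonneg (Real.rpow_nonneg (freqNormSq_nonneg k) _) (sq_nonneg _)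
  have hHP : H ≤ P := by
    rw [hP, integral_inner_self_fracLaplacian_eq_tsum (by norm_num) hv, hH]
    refine (hv.summable_freqNormSq_rpow_mul_norm_sq (by norm_num)).tsum_le_tsum (fun k => ?_)
      (summable_fracSymbol_mul_norm_sq (by norm_num) hv)
    refine mul_le_mul_of_nonneg_right ?_ (sq_nonneg _)
    have hf := freqNormSq_nonneg k
    rw [fracSymbol, Real.mul_rpow (by positivity) hf]
    have h1 : (1 : ℝ) ≤ (4 * Real.pi ^ 2) ^ (3 / 4 : ℝ) := by
      refine Real.one_le_rpow ?_ (by norm_num)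
      have := Real.pi_gt_three; nlinarith
    calc freqNormSq k ^ (3 / 4 : ℝ) = 1 * freqNormSq k ^ (3 / 4 : ℝ) := (one_mul _).symm
      _ ≤ (4 * Real.pi ^ 2) ^ (3 / 4 : ℝ) * freqNormSq k ^ (3 / 4 : ℝ) :=
          mul_le_mul_of_nonneg_right h1 (Real.rpow_nonneg hf _)
  calc ∫ x, ‖v x‖ ^ 4 ≤ C * H ^ 2 := h
    _ ≤ C * P ^ 2 := mul_le_mul_of_nonneg_left (pow_le_pow_left₀ hH0 hHP 2) hC0.le

/-- **`∫|∇u|⁴ ≤ C ‖Λ^{3/4}∇u‖₂⁴` on `T³`:** there is `C ≥ 0` with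
`∫ (∑ₘ ‖∂ₘu‖²)² ≤ C · (fracGradPairing (3/4) u)²` for every smooth `u`
(`(∑ₘ aₘ)² ≤ 3∑ₘ aₘ²`, the previous item for each zero-mean field `∂ₘu`, `∑ₘ Pₘ² ≤ (∑ₘ Pₘ)²`). [ours] -/
theorem exists_integral_gradSq_sq_le_fracGradPairing_sq :
    ∃ C : ℝ, 0 ≤ C ∧ ∀ u : UnitAddTorus (Fin 3) → EuclideanSpace ℝ (Fin 3), Torus.IsSmooth u →
      ∫ x, (∑ m, ‖Torus.partialDeriv m u x‖ ^ 2) ^ 2 ≤ C * fracGradPairing (3 / 4) u ^ 2 := by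
  obtain ⟨C, hC0, hC⟩ := exists_integral_norm_pow_four_le_pairing_sq
  refine ⟨3 * C, by positivity, fun u hu => ?_⟩
  have hDs : ∀ m, Torus.IsSmooth (Torus.partialDeriv m u) := fun m => hu.partialDeriv m
  set P : Fin 3 → ℝ := fun m =>
    ∫ x, ⟪Torus.partialDeriv m u x, fracLaplacian (3 / 4) (Torus.partialDeriv m u) x⟫_ℝ with hPdef
  have hP0 : ∀ m, 0 ≤ P m := fun m => by
    simp only [hPdef]
    rw [integral_inner_self_fracLaplacian_eq_tsum (by norm_num) (hDs m)]
    exact tsum_nonneg fun k => mul_nonneg (fracSymbol_nonneg _ k) (sq_nonneg _)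
  have hPsum : fracGradPairing (3 / 4) u = ∑ m, P m := rfl
  -- pointwise `(∑ₘ aₘ)² ≤ 3 ∑ₘ aₘ²`
  have hpt : ∀ x, (∑ m, ‖Torus.partialDeriv m u x‖ ^ 2) ^ 2 ≤
      3 * ∑ m, (‖Torus.partialDeriv m u x‖ ^ 2) ^ 2 := fun x => by
    have h := sq_sum_le_card_mul_sum_sq (s := Finset.univ) (f := fun m => ‖Torus.partialDeriv m u x‖ ^ 2)
    simpa [Finset.card_univ, Fintype.card_fin] using h
  have hint4 : ∀ m, Integrable (fun x => (‖Torus.partialDeriv m u x‖ ^ 2) ^ 2) volume := fun m =>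
    (((hDs m).continuous.norm.pow 2).pow 2).integrable_unitAddTorus
  have hθc : Continuous fun x => ∑ m, ‖Torus.partialDeriv m u x‖ ^ 2 :=
    continuous_finsetSum _ fun m _ => (hDs m).continuous.norm.pow 2
  calc ∫ x, (∑ m, ‖Torus.partialDeriv m u x‖ ^ 2) ^ 2
      ≤ ∫ x, 3 * ∑ m, (‖Torus.partialDeriv m u x‖ ^ 2) ^ 2 :=
        integral_mono (hθc.pow 2).integrable_unitAddTorus
          ((integrable_finsetSum _ fun m _ => hint4 m).const_mul 3) hpt
    _ = 3 * ∑ m, ∫ x, ‖Torus.partialDeriv m u x‖ ^ 4 := by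
        rw [integral_const_mul, integral_finsetSum _ fun m _ => hint4 m]
        congr 1
        refine Finset.sum_congr rfl fun m _ => integral_congr_ae (ae_of_all _ fun x => ?_)
        ring
    _ ≤ 3 * ∑ m, C * P m ^ 2 := by
        gcongr with m _
        exact hC _ (hDs m) (hasZeroMean_partialDeriv hu m)
    _ = 3 * C * ∑ m, P m ^ 2 := by rw [← Finset.mul_sum]; ring
    _ ≤ 3 * C * (∑ m, P m) ^ 2 := by
        gcongr
        exact sum_sq_le_sq_sum_of_nonneg fun m _ => hP0 m
    _ = 3 * C * fracGradPairing (3 / 4) u ^ 2 := by rw [hPsum]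
/-! ## 4. `‖Λ^{1/4}∇u‖₂² = ‖Λ^{5/4}u‖₂²`: the energy dissipation of the `α = 5/4` model -/

/-- `∑ₘ ‖(∂ₘu)^(k)‖² = 4π²|k|² ‖û(k)‖²` (`(∂ₘu)^(k) = 2πi kₘ û(k)`). [ours, bookkeeping] -/
theorem sum_gradCoeffSq_eq {u : UnitAddTorus (Fin 3) → EuclideanSpace ℝ (Fin 3)} (hu : Torus.IsSmooth u)
    (k : Fin 3 → ℤ) :
    ∑ m, gradCoeffSq u m k =
      4 * Real.pi ^ 2 * freqNormSq k * ‖UnitAddTorus.mFourierCoeff (EuclideanSpace.complexify ∘ u) k‖ ^ 2 := by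
  have hc : ∀ m : Fin 3, ‖(2 * Real.pi * Complex.I * (k m : ℂ))‖ ^ 2 = 4 * Real.pi ^ 2 * ((k m : ℤ) : ℝ) ^ 2 := by
    intro m
    rw [show (2 * Real.pi * Complex.I * (k m : ℂ)) = ((2 * Real.pi * ((k m : ℤ) : ℝ) : ℝ) : ℂ) * Complex.I by
      push_cast; ring, Complex.norm_mul, Complex.norm_I, mul_one, Complex.norm_real, Real.norm_eq_abs,
      sq_abs]
    ring
  unfold gradCoeffSq
  simp_rw [mFourierCoeff_complexify_partialDeriv hu, norm_smul, mul_pow, hc, ← Finset.sum_mul,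
    ← Finset.mul_sum]
  rfl

/-- **`‖Λ^{1/4}∇u‖₂² = ‖Λ^{5/4}u‖₂²`** on the Fourier side:
`fracGradPairing (1/4) u = ∑ₖ (4π²|k|²)^{5/4} ‖û(k)‖² = ∫⟪u, (−Δ)^{5/4}u⟫` for smooth `u` — the
energy-dissipation rate (per unit viscosity) of the `α = 5/4` model. [ours, bookkeeping] -/
theorem fracGradPairing_quarter_eq {u : UnitAddTorus (Fin 3) → EuclideanSpace ℝ (Fin 3)}
    (hu : Torus.IsSmooth u) :
    fracGradPairing (1 / 4) u = ∫ x, ⟪u x, fracLaplacian (5 / 4) u x⟫_ℝ := by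
  rw [fracGradPairing_eq_sum_tsum (by norm_num) hu, integral_inner_self_fracLaplacian_eq_tsum (by norm_num) hu]
  have hS : ∀ m, Summable fun k : Fin 3 → ℤ => fracSymbol (1 / 4) k * gradCoeffSq u m k := fun m =>
    summable_fracSymbol_mul_norm_sq (by norm_num) (hu.partialDeriv m)
  rw [← Summable.tsum_finsetSum (fun m _ => hS m)]
  refine tsum_congr fun k => ?_
  rw [← Finset.mul_sum, sum_gradCoeffSq_eq hu k]
  have hf := freqNormSq_nonneg k
  have hx : 0 ≤ 4 * Real.pi ^ 2 * freqNormSq k := by positivity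
  simp only [fracSymbol]
  rw [show (5 / 4 : ℝ) = 1 / 4 + 1 by norm_num, Real.rpow_add' hx (by norm_num), Real.rpow_one]
  ring
end HyperNS

end Summit.NavierStokesRegularity.FunctionalMining

end
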